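import Literature.MathematicalPhysics.QuantumFieldTheory.Balaban1983to89.B8Ineq159FlatCovCubeMemberRec

/-!
# `Balaban1983to89.B8Ineq159FlatCovDentedCubeMemberRec` — [Balaban1985RegularSpaces] (1.59) p. 86 ∕ (1.62) p. 87 AT `U₀ = 1` (= [Balaban1985BackgroundPropagators] Thm 3.3) FOR THE
# RECORD's LINEARISED AVERAGING `Q_j(1) = linCovIterZ L 1` ([Balaban1987RG1] (0.4)) ON THE DENTED CENTRED CUBE TOWER `{Ω′_j}` OF [Balaban1985Variational] (148)–(150): the named fact
# **`B8Ineq159FlatCovPrintedRec.Ineq159FlatDentedCubeMemberCovPrintedZ (d+1) (ℓ+1)` PROVED for every odd `L = ℓ+1 ≥ 5`**, by the BOOTSTRAP of `B8Ineq159FlatCovCubeMemberRec` from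
# the proved straight twin `B8Ineq159FlatDentedCubeMemberPrintedRec.ineq159FlatDentedCubeMemberPrintedZ_holds`; with it BOTH displayed premises of the record crown
# `gaugedBoundB8DZ_dentedMember_of_cov159` are discharged (`ineq159FlatCovPrintedZ_holds`)

statement-level skeleton of published theorems with citation tags; proofs where landed; nothing here is a claim about the Yang–Mills mass gap

CITATION HEADER (lean-in-tree rule).  Cell `pub-ymgap` (HUMAN RULING D-0062), «N05-REC» road, seat `pub-ymgap-dag-n05-cov` g0 (director-ym R509 (a)); the named facts were typed by
dag-n05-e g39 (INTENT-8, `B8Ineq159FlatCovPrintedRec`).  `--kind proof --supports stmt-QuantumFields-20541` (K0⁷; count-neutral).  [6] = [Balaban1985RegularSpaces] (1.55)–(1.59) p. 86,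
(1.62) p. 87, (1.31) p. 82, (1.131) p. 99, p. 98; [15] = [Balaban1985Variational] (148)–(152) p. 301; [4] = [Balaban1985BackgroundPropagators] (3.4) p. 391, (3.14)–(3.15) p. 393,
Thm 3.3 p. 399; [3] = [Balaban1985Averaging] (89)–(92) p. 31, (127) p. 37; [I] = [Balaban1987RG1] (0.3)–(0.4) pp. 252–253; [B6] = [Balaban1984PropagatorsII] (2.3) p. 224.  REUSED BY NAME:
the straight fact and its proof (`B8Ineq159FlatDentedCubeMemberPrintedRec.{Ineq159FlatDentedCubeMemberPrintedZ, ineq159FlatDentedCubeMemberPrintedZ_holds}`, dag-n05-e g38), dag-n07-w3's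
`Node00.CubeB8DZ` with `sq_of_lt`, `sq_subset_cube`, `mem_lamBPZ_iff`, the sibling `B8Ineq159FlatCovCubeMemberRec` (§1–§4: `box_subset_cubeZ_pred`, `sideTouches_of_mem`, `bondTouches_of_mem`,
`not_sideTouches_of_lt_two`, `abs_apply_le_l1`, `sum_pow_lt_le`, `asum_smul_complex`, `asum_plaqWord_eq_smul_plaqCovDeriv`, `iEta_eq_smul`, `norm_dcovF_one_le`,
`ineq159FlatCubeMemberCovPrintedZ_holds`), `B7Prop4FlatCarriedLetterRec.linCovIterZ_one_eq`, `B7Prop4FlatCarriedLetterOscRec.norm_carried_flat_le_osc`,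
`B8FlatCurlOscillationZd.exists_plaqCovDeriv_osc_const`.

THE PROOF.  Verbatim the bootstrap of the sibling file (see its docstring), with two bookkeeping changes: the bootstrap quantity `G` is the maximum over the bonds side-touching the
DENTED tower `Ω′_j = c.sq j ⊆ □_j` (`exists_weighted_max_of_subset`, any tower inside `□₀`), and the KEY estimate is restated with its two inputs at the single level `j−1` as
MEMBERSHIP in `□_{j−1}` (`norm_carried_iEta_le_level`), which the dented tower supplies because `Ω′_{j−1} = □_{j−1}` for `j ≤ k` ([15] (150)).

WHAT IS PROVED (sorry-free; proof lane — 0 `def`).  §1 ★ `exists_weighted_max_of_subset`, `exists_near_of_mem_lamBPZ`.  §2 ★★ `norm_carried_iEta_le_level` (the KEY estimate with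
level-`(j−1)` membership inputs).  §3 ★★★ `covDented_of_straight`, ★★★ **`ineq159FlatDentedCubeMemberCovPrintedZ_holds (d ℓ) (hℓ : 4 ≤ ℓ) (hodd : Odd (ℓ+1))`** — UNCONDITIONAL — and
★★★ `ineq159FlatCovPrintedZ_holds` (both facts, as the crown consumes them).
HONEST SCOPE.  The two displayed premises of the record crown are theorems; `HThm4Rec` itself UNDISCHARGED here; N05 ∕ N07 NOT discharged by this file; COUNT of record unmoved · K
numerically unchanged; one finite `𝕋⁴` programme at fixed `ε`, Bałaban AS PRINTED plus the bootstrap (ours); nothing continuum ∕ ℝ⁴ ∕ OS ∕ mass-gap ∕ Clay.  NEW file; modifies nothing.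
No `instance`, no `notation`, no `sorry`.
-/

set_option autoImplicit false

noncomputable section

open scoped BigOperators
open Finset

namespace Literature.MathematicalPhysics.QuantumFieldTheory.Balaban1983to89.B8Ineq159FlatCovDentedCubeMemberRec

open B7Prop1Explicit hiding Site
open B7Prop1Explicit renaming Site → SiteZ
open B7Prop1Local (InBox)
open BlockAveragingZd (ctrShift)
open Literature.MathematicalPhysics.QuantumLattice (blockMap)
open B8Eq131CubesRec (sqLoZ sqHiZ inLoZ inHiZ cubeZ cube_eq)
open B8Eq131CubesAdmissibleRec (cubeFamZ)
open B8Ineq132 (covDerivFwd BondTouches PlaqTouches)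
open B8Eq140Level (SideTouches IsSide)
open B8Eq146AExpansion (iEta plaqCovDeriv plaqCovDeriv_eq_covDerivFwd)
open B8Eq155JBound (Jcur)
open B8Eq138LandauZd (covLap)
open B8Eq138LandauZdRec (IsLandau138Z)
open B8FlatOperatorsTranslateLocal (near_of_sideTouches)
open B7SectEFLinearisationRec (linQIterZ linCovIterZ rlamZ)
open B7Prop3GaugeCarryRec (lamZ)
open B7Prop3PureGaugeRec (dcovF dcovF_apply)
open B7Prop4GaugeInductionRec (carryIter carryIter_zero)
open B7Prop4FlatCarriedLetterRec (linCovIterZ_one_eq)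
open B7Prop4FlatCarriedLetterOscRec (norm_carried_flat_le_osc)
open B4Eq19LatticeOperators (box mem_box)
open B8Ineq159FlatCovCubeMemberRec (box_subset_cubeZ_pred sideTouches_of_mem bondTouches_of_mem not_sideTouches_of_lt_two abs_apply_le_l1 sum_pow_lt_le asum_smul_complex
  asum_plaqWord_eq_smul_plaqCovDeriv iEta_eq_smul norm_dcovF_one_le ineq159FlatCubeMemberCovPrintedZ_holds)
open B8Ineq159FlatDentedCubeMemberPrintedRec (Ineq159FlatDentedCubeMemberPrintedZ ineq159FlatDentedCubeMemberPrintedZ_holds)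
open B8Ineq159FlatCovPrintedRec (Ineq159FlatCubeMemberCovPrintedZ Ineq159FlatDentedCubeMemberCovPrintedZ)
open Node00 (CubeB8DZ)

variable {d : ℕ}

/-! ## §1 Bookkeeping on a tower inside `□₀` -/

section Bookkeeping

/-- ★ **THE FINITE MAXIMUM OF THE WEIGHTED GRADIENTS over the bonds side-touching ANY tower `{S_j}_{j ≤ m}` inside `□₀`** (least-upper-bound form).
[cite: Balaban1985RegularSpaces, (1.59) p.86, (1.62) p.87, p.98; Balaban1985Variational, (148)–(150) p.301] -/
theorem exists_weighted_max_of_subset {L : ℕ} (η : ℝ) (a : SiteZ (d + 1)) (M ρ k m : ℕ) (S : ℕ → Set (SiteZ (d + 1)))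
    (hS : ∀ j, j ≤ m → S j ⊆ cubeZ L a M ρ k 0) (φ : SiteZ (d + 1) → Fin (d + 1) → ℂ) :
    ∃ G : ℝ, 0 ≤ G ∧
      (∀ j, j ≤ m → ∀ (y : SiteZ (d + 1)) (τ ν : Fin (d + 1)), SideTouches (S j) y τ →
        ((L : ℝ) ^ j * η) ^ 2 * ‖covDerivFwd η (1 : SiteZ (d + 1) → Fin (d + 1) → ℂˣ) ν (fun x => φ x τ) y‖ ≤ G) ∧
      (∀ G' : ℝ, 0 ≤ G' → (∀ j, j ≤ m → ∀ (y : SiteZ (d + 1)) (τ ν : Fin (d + 1)), SideTouches (S j) y τ →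
        ((L : ℝ) ^ j * η) ^ 2 * ‖covDerivFwd η (1 : SiteZ (d + 1) → Fin (d + 1) → ℂˣ) ν (fun x => φ x τ) y‖ ≤ G') → G ≤ G') := by
  classical
  set B : Finset (SiteZ (d + 1)) := Fintype.piFinset fun i => Finset.Icc (sqLoZ L a ρ k 0 i - 1) (sqHiZ L a M ρ k 0 i + 1) with hB
  set s : Finset (ℕ × SiteZ (d + 1) × Fin (d + 1) × Fin (d + 1)) := (Finset.range (m + 1)) ×ˢ (B ×ˢ (Finset.univ ×ˢ Finset.univ)) with hs
  set g : ℕ × SiteZ (d + 1) × Fin (d + 1) × Fin (d + 1) → ℝ := fun p =>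
    if SideTouches (S p.1) p.2.1 p.2.2.1 then
      ((L : ℝ) ^ p.1 * η) ^ 2 * ‖covDerivFwd η (1 : SiteZ (d + 1) → Fin (d + 1) → ℂˣ) p.2.2.2 (fun x => φ x p.2.2.1) p.2.1‖ else 0 with hg
  have hg0 : ∀ p, 0 ≤ g p := fun p => by rw [hg]; dsimp only; split_ifs <;> positivity
  have hmem : ∀ j, j ≤ m → ∀ (y : SiteZ (d + 1)) (τ ν : Fin (d + 1)), SideTouches (S j) y τ → (j, y, τ, ν) ∈ s := by
    intro j hj y τ ν hside
    obtain ⟨⟨s₀, hs₀, hclose⟩, -⟩ := near_of_sideTouches hside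
    have hbox : InBox (sqLoZ L a ρ k 0) (sqHiZ L a M ρ k 0) s₀ := hS j hj hs₀
    simp only [hs, Finset.mem_product, Finset.mem_range, Finset.mem_univ, and_true, hB, Fintype.mem_piFinset, Finset.mem_Icc]
    refine ⟨Nat.lt_succ_of_le hj, fun i => ?_⟩
    have h1 := hclose i
    obtain ⟨h2, h3⟩ := hbox i
    rw [abs_le] at h1
    constructor <;> linarith
  have hval : ∀ j (y : SiteZ (d + 1)) (τ ν : Fin (d + 1)), SideTouches (S j) y τ →
      g (j, y, τ, ν) = ((L : ℝ) ^ j * η) ^ 2 * ‖covDerivFwd η (1 : SiteZ (d + 1) → Fin (d + 1) → ℂˣ) ν (fun x => φ x τ) y‖ := by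
    intro j y τ ν hside; rw [hg]; dsimp only; rw [if_pos hside]
  by_cases hne : s.Nonempty
  · obtain ⟨p, hp, hmax⟩ := Finset.exists_max_image s g hne
    refine ⟨g p, hg0 p, fun j hj y τ ν hside => ?_, fun G' hG' hub => ?_⟩
    · rw [← hval j y τ ν hside]; exact hmax _ (hmem j hj y τ ν hside)
    · rw [hg]; dsimp only
      split_ifs with hside
      · have hjm : p.1 ≤ m := Nat.lt_succ_iff.mp (Finset.mem_range.mp (Finset.mem_product.mp hp).1)
        exact hub p.1 hjm p.2.1 p.2.2.1 p.2.2.2 hside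
      · exact hG'
  · refine ⟨0, le_rfl, fun j hj y τ ν hside => absurd ⟨_, hmem j hj y τ ν hside⟩ hne, fun G' hG' _ => hG'⟩

/-- **Both endpoints of a bond of print's class `c.lamBPZ j` on the dented member are within label-distance `1` of `□_j^{(j)}`.** [cite: Balaban1984PropagatorsII, (2.3) p.224; Balaban1985Variational, (148)–(150) p.301] -/
theorem exists_near_of_mem_lamBPZ {L K : ℕ} {Ω : ℕ → Set (SiteZ d)} (c : CubeB8DZ d L K Ω) {j : ℕ} {b : SiteZ d × Fin d} (hb : b ∈ c.lamBPZ j) :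
    ∃ w, InBox (sqLoZ L c.a c.ρ c.k j) (sqHiZ L c.a c.M c.ρ c.k j) w ∧ (∀ i, |b.1 i - w i| ≤ 1) ∧ (∀ i, |(b.1 + e b.2) i - w i| ≤ 1) := by
  have he : ∀ i, |(e b.2 : SiteZ d) i| ≤ 1 := fun i => by rw [e_apply]; split_ifs <;> simp
  rcases ((Node00.CubeB8DZ.mem_lamBPZ_iff c j b).1 hb).2.1 with ⟨h, -⟩ | ⟨h, -⟩
  · exact ⟨b.1, h, fun i => by simp, fun i => by simpa using he i⟩
  · refine ⟨b.1 + e b.2, h, fun i => ?_, fun i => by simp⟩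
    rw [show b.1 i - (b.1 + e b.2) i = -((e b.2 : SiteZ d) i) by simp, abs_neg]
    exact he i

end Bookkeeping

/-! ## §2 The KEY estimate with level-`(j−1)` membership inputs -/

section Key

/-- ★★ **THE KEY ESTIMATE, MEMBERSHIP FORM** (`L = 2s+1 ≥ 3`, `j = j₀+1 ≤ k`, `t ≥ 1`, annulus width `L^j + (4t²(ds+2L)L^j + 3) ≤ ρL^{j₀}`): if `G` bounds `(L^{j₀}η)²‖D^η_{1,ν}φ_τ(y)‖` and `N`
bounds `(L^{j₀}η)³‖J(φ)_τ(y)‖` at every `y ∈ □_{j₀}`, then at every level-`j` label `z` within label-distance `1` of `□_j^{(j)}`: `‖Θ_j(iηφ)(z)‖ ≤ (d·s)²·C·(2L²·G + t²(ds+2L)L³·N)∕t`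
(`C` the constant of `B8FlatCurlOscillationZd.exists_plaqCovDeriv_osc_const`) — the sibling's `norm_carried_iEta_le` with its two inputs read at the single level `j₀` as membership in
`□_{j₀}`, so that it serves any tower whose level `j₀` IS `□_{j₀}` (the dented tower: `Ω′_{j₀} = □_{j₀}` for `j₀ < k`). [cite: Balaban1985RegularSpaces, (1.59) p.86, (1.62) p.87, p.98;
Balaban1985Variational, (150) p.301; Balaban1985Averaging, (127) p.37; Balaban1987RG1, (0.3)–(0.4) pp.252–253] -/
theorem norm_carried_iEta_le_level {L s : ℕ} (hLs : L = 2 * s + 1) (hs : 1 ≤ s) (hL : Odd L)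
    {C : ℝ} (hC0 : 0 ≤ C)
    (hC : ∀ (K : ℕ), 3 ≤ K → ∀ (η : ℝ), 0 < η → ∀ (A : SiteZ d → Fin d → ℂ) (a : SiteZ d) (Mu m : ℝ), 0 ≤ Mu → 0 ≤ m →
      (∀ y ∈ box a (4 * (K : ℤ) + 2), ∀ κ ν, ‖plaqCovDeriv η (1 : SiteZ d → Fin d → ℂˣ) A κ ν y‖ ≤ Mu) →
      (∀ y ∈ box a (4 * (K : ℤ) + 2), ∀ κ, ‖Jcur η (1 : SiteZ d → Fin d → ℂˣ) A κ y‖ ≤ m) →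
      ∀ (μ ν : Fin d) (x' : SiteZ d) (ρ₀ : ℕ), 1 ≤ ρ₀ → ρ₀ ≤ K → x' ∈ box a (ρ₀ : ℤ) →
        ‖plaqCovDeriv η (1 : SiteZ d → Fin d → ℂˣ) A μ ν x' - plaqCovDeriv η (1 : SiteZ d → Fin d → ℂˣ) A μ ν a‖ ≤ C * (Mu + K * (η * m)) * Real.sqrt ((ρ₀ : ℝ) / K))
    {η : ℝ} (hη : 0 < η) (φ : SiteZ d → Fin d → ℂ) (a : SiteZ d) (M ρ k : ℕ) {j₀ : ℕ} (hjk : j₀ + 1 ≤ k)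
    {N : ℝ} (hN : 0 ≤ N)
    (hJ : ∀ (y : SiteZ d) (τ : Fin d), y ∈ cubeZ L a M ρ k j₀ → ((L : ℝ) ^ j₀ * η) ^ 3 * ‖Jcur η (1 : SiteZ d → Fin d → ℂˣ) φ τ y‖ ≤ N)
    {G : ℝ} (hG0 : 0 ≤ G)
    (hG : ∀ (y : SiteZ d) (τ ν : Fin d), y ∈ cubeZ L a M ρ k j₀ → ((L : ℝ) ^ j₀ * η) ^ 2 * ‖covDerivFwd η (1 : SiteZ d → Fin d → ℂˣ) ν (fun x => φ x τ) y‖ ≤ G)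
    (t : ℕ) (ht : 1 ≤ t)
    (hρ : L ^ (j₀ + 1) + (4 * (t ^ 2 * ((d * s + 2 * L) * L ^ (j₀ + 1))) + 3) ≤ ρ * L ^ j₀)
    (z w : SiteZ d) (hw : InBox (sqLoZ L a ρ k (j₀ + 1)) (sqHiZ L a M ρ k (j₀ + 1)) w) (hzw : ∀ i, |z i - w i| ≤ 1) :
    ‖carryIter (fun _ θ w' => rlamZ L (1 : SiteZ d → Fin d → ℂˣ) θ ((L : ℤ) • w')) (fun _ A w' => lamZ L (1 : SiteZ d → Fin d → ℂˣ) A ((L : ℤ) • w'))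
        (linQIterZ L (iEta η φ)) (j₀ + 1) z‖
      ≤ ((d : ℝ) * s) ^ 2 * C * (2 * (L : ℝ) ^ 2 * G + (t : ℝ) ^ 2 * ((d : ℝ) * s + 2 * L) * (L : ℝ) ^ 3 * N) / t := by
  -- ### the letters
  have hL3 : 3 ≤ L := by omega
  have hLpos : 0 < L := by omega
  set ρ₀ : ℕ := (d * s + 2 * L) * L ^ (j₀ + 1) with hρ₀
  set K : ℕ := t ^ 2 * ρ₀ with hK
  have hLj1 : 1 ≤ L ^ (j₀ + 1) := Nat.one_le_pow _ _ hLpos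
  have hρ₀6 : 6 ≤ ρ₀ := by
    have h1 : 6 ≤ d * s + 2 * L := by omega
    calc 6 = 6 * 1 := by norm_num
      _ ≤ (d * s + 2 * L) * L ^ (j₀ + 1) := Nat.mul_le_mul h1 hLj1
  have ht2 : 1 ≤ t ^ 2 := Nat.one_le_pow _ _ (by omega)
  have hρ₀K : ρ₀ ≤ K := by rw [hK]; exact Nat.le_mul_of_pos_left _ (by omega)
  have hK3 : 3 ≤ K := le_trans (by omega) hρ₀K
  have hρ₀1 : 1 ≤ ρ₀ := le_trans (by norm_num) hρ₀6
  -- the centre `y = L^j z` and the Campanato box inside `□_{j₀}`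
  set y : SiteZ d := ((L : ℤ) ^ (j₀ + 1)) • z with hy
  have hy_apply : ∀ i, y i = (L : ℤ) ^ (j₀ + 1) * z i := fun i => by rw [hy, Pi.smul_apply, smul_eq_mul]
  have hinbox : ∀ x : SiteZ d, x ∈ box y (4 * (K : ℤ) + 2) → x ∈ cubeZ L a M ρ k j₀ := by
    intro x hx
    refine box_subset_cubeZ_pred hL a M ρ k j₀ hjk (4 * (t ^ 2 * ((d * s + 2 * L) * L ^ (j₀ + 1))) + 3) hρ z w hw hzw x fun i => ?_
    have h := (mem_box.1 hx) i
    rw [hy_apply] at h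
    have hKz : (K : ℤ) = (t : ℤ) ^ 2 * (((d : ℤ) * s + 2 * L) * (L : ℤ) ^ (j₀ + 1)) := by rw [hK, hρ₀]; push_cast; ring
    push_cast
    linarith
  -- the level-`j₀` weights
  set W : ℝ := (L : ℝ) ^ j₀ * η with hW
  have hW0 : 0 < W := by positivity
  set Mu : ℝ := 2 * G / W ^ 2 with hMu
  set mJ : ℝ := N / W ^ 3 with hmJ
  have hMu0 : 0 ≤ Mu := by positivity
  have hmJ0 : 0 ≤ mJ := by positivity
  have hF : ∀ x ∈ box y (4 * (K : ℤ) + 2), ∀ κ ν, ‖plaqCovDeriv η (1 : SiteZ d → Fin d → ℂˣ) φ κ ν x‖ ≤ Mu := by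
    intro x hx κ ν
    have hxΩ := hinbox x hx
    have h1 := hG x ν κ hxΩ
    have h2 := hG x κ ν hxΩ
    rw [plaqCovDeriv_eq_covDerivFwd]
    have hW2 : 0 < W ^ 2 := by positivity
    rw [hMu, le_div_iff₀ hW2]
    calc ‖covDerivFwd η 1 κ (fun y => φ y ν) x - covDerivFwd η 1 ν (fun y => φ y κ) x‖ * W ^ 2
        ≤ (‖covDerivFwd η 1 κ (fun y => φ y ν) x‖ + ‖covDerivFwd η 1 ν (fun y => φ y κ) x‖) * W ^ 2 :=
          mul_le_mul_of_nonneg_right (norm_sub_le _ _) hW2.le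
      _ ≤ 2 * G := by rw [hW] at *; nlinarith [h1, h2]
  have hJ' : ∀ x ∈ box y (4 * (K : ℤ) + 2), ∀ κ, ‖Jcur η (1 : SiteZ d → Fin d → ℂˣ) φ κ x‖ ≤ mJ := by
    intro x hx κ
    have h1 := hJ x κ (hinbox x hx)
    have hW3 : 0 < W ^ 3 := by positivity
    rw [hmJ, le_div_iff₀ hW3, mul_comm]
    exact h1
  -- the oscillation of the flat plaquette derivative over the `ρ₀`-ball
  have hosc : ∀ (x : SiteZ d) (μ ν : Fin d), l1 (x - y) ≤ ρ₀ →
      ‖plaqCovDeriv η (1 : SiteZ d → Fin d → ℂˣ) φ μ ν x - plaqCovDeriv η (1 : SiteZ d → Fin d → ℂˣ) φ μ ν y‖ ≤ C * (Mu + K * (η * mJ)) * (1 / t) := by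
    intro x μ ν hx
    have hxbox : x ∈ box y (ρ₀ : ℤ) := by
      rw [mem_box]; intro i
      exact (abs_apply_le_l1 (x - y) i).trans (by exact_mod_cast hx)
    have h := hC K hK3 η hη φ y Mu mJ hMu0 hmJ0 hF hJ' μ ν x ρ₀ hρ₀1 hρ₀K hxbox
    have hsqrt : Real.sqrt ((ρ₀ : ℝ) / K) = 1 / t := by
      rw [hK]; push_cast
      have hρ₀r : (0 : ℝ) < ρ₀ := by exact_mod_cast hρ₀1
      have htr : (0 : ℝ) < t := by exact_mod_cast ht
      rw [show (ρ₀ : ℝ) / ((t : ℝ) ^ 2 * ρ₀) = (1 / t) ^ 2 by field_simp, Real.sqrt_sq (by positivity)]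
    rwa [hsqrt] at h
  -- the oscillation of the curl of `iηφ` itself
  set Mosc : ℝ := η * (η * (C * (Mu + K * (η * mJ)) * (1 / t))) with hMosc
  have hMosc0 : 0 ≤ Mosc := by positivity
  have hM : ∀ (x : SiteZ d) (μ ν : Fin d), l1 (x - y) ≤ ρ₀ → ‖asum (iEta η φ) x (plaqWord μ ν) - asum (iEta η φ) y (plaqWord μ ν)‖ ≤ Mosc := by
    intro x μ ν hx
    rw [iEta_eq_smul, asum_smul_complex, asum_smul_complex, asum_plaqWord_eq_smul_plaqCovDeriv hη.ne', asum_plaqWord_eq_smul_plaqCovDeriv hη.ne', ← smul_sub, ← smul_sub,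
      norm_smul, norm_smul, Complex.norm_mul, Complex.norm_I, one_mul, Complex.norm_real, Real.norm_of_nonneg hη.le]
    exact mul_le_mul_of_nonneg_left (mul_le_mul_of_nonneg_left (hosc x μ ν hx) hη.le) hη.le
  -- the carried letter of `iηφ` by the oscillation form of the curvature bound
  have hz : l1 (((L : ℤ) ^ (j₀ + 1)) • z - y) + (d * s + 2 * L) * L ^ (j₀ + 1) ≤ ρ₀ := by rw [hy, sub_self]; simp [l1, hρ₀]
  have hΘ := norm_carried_flat_le_osc L hLs hs (iEta η φ) y ρ₀ hMosc0 hM (j₀ + 1) z hz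
  refine hΘ.trans ?_
  -- ### arithmetic: the weights telescope
  have hLr : (2 : ℝ) ≤ (L : ℝ) ^ 2 := by
    have : (3 : ℝ) ≤ L := by exact_mod_cast hL3
    nlinarith
  have hgeom := sum_pow_lt_le hLr (j₀ + 1)
  have hds : 0 ≤ ((d : ℝ) * s) ^ 2 := by positivity
  calc ((d : ℝ) * s) ^ 2 * Mosc * ∑ i ∈ range (j₀ + 1), ((L : ℝ) ^ 2) ^ i
      ≤ ((d : ℝ) * s) ^ 2 * Mosc * ((L : ℝ) ^ 2) ^ (j₀ + 1) := mul_le_mul_of_nonneg_left hgeom (by positivity)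
    _ = ((d : ℝ) * s) ^ 2 * C * (2 * (L : ℝ) ^ 2 * G + (t : ℝ) ^ 2 * ((d : ℝ) * s + 2 * L) * (L : ℝ) ^ 3 * N) / t := by
      rw [hMosc, hMu, hmJ, hK, hρ₀, hW]
      push_cast
      have hLr0 : (L : ℝ) ≠ 0 := by exact_mod_cast hLpos.ne'
      have hη0 : η ≠ 0 := hη.ne'
      have htr : (t : ℝ) ≠ 0 := by exact_mod_cast (show t ≠ 0 by omega)
      have hpow : ((L : ℝ) ^ 2) ^ (j₀ + 1) = ((L : ℝ) ^ j₀) ^ 2 * (L : ℝ) ^ 2 := by ring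
      rw [hpow]
      field_simp
      ring

end Key

/-! ## §3 THE BOOTSTRAP on the dented tower -/

section Bootstrap

/-- ★★★ **THE BOOTSTRAP ON THE DENTED TOWER: `Ineq159FlatDentedCubeMemberPrintedZ (d+1) (ℓ+1) → Ineq159FlatDentedCubeMemberCovPrintedZ (d+1) (ℓ+1)`** (odd `ℓ+1 ≥ 5`) — the argument
of `B8Ineq159FlatCovCubeMemberRec.cov_of_straight` verbatim, with `G` the maximum over the bonds side-touching `{Ω′_j}` and the KEY estimate fed at level `j−1 < k` through
`Ω′_{j−1} = □_{j−1}` ([15] (150)). [cite: Balaban1985RegularSpaces, (1.59) p.86, (1.62) p.87, p.98; Balaban1985Variational, (148)–(152) p.301; Balaban1985BackgroundPropagators, Thm 3.3 p.399;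
Balaban1987RG1, (0.3)–(0.4) pp.252–253] -/
theorem covDented_of_straight (d ℓ : ℕ) (hℓ : 4 ≤ ℓ) (hodd : Odd (ℓ + 1)) (hS : Ineq159FlatDentedCubeMemberPrintedZ (d + 1) (ℓ + 1)) :
    Ineq159FlatDentedCubeMemberCovPrintedZ (d + 1) (ℓ + 1) := by
  classical
  -- ### `d + 1 = 1`: vacuous
  rcases Nat.eq_zero_or_pos d with hd0 | hdpos
  · subst hd0
    refine ⟨1, 0, 0, 0, 0, one_pos, ?_⟩
    intro η hη K Ω c s R hM0 hρdiv hMdiv hRρ hR0 hN01 hρ0 hΩ φ hLan hsupp N hN0 hJ hQ hout j hjk y τ hside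
    exact absurd hside (not_sideTouches_of_lt_two (by norm_num) _ _ _)
  have hd2 : 2 ≤ d + 1 := by omega
  -- ### the letters
  have hoddL : Odd (ℓ + 1) := hodd
  obtain ⟨sL, hsL⟩ := hodd
  have hsL2 : 2 ≤ sL := by omega
  have hLs : ℓ + 1 = 2 * sL + 1 := by omega
  obtain ⟨B₀, ρ₀, M₀, N₀, R₀, hB₀, HS⟩ := hS
  obtain ⟨C, hC0, hC⟩ := B8FlatCurlOscillationZd.exists_plaqCovDeriv_osc_const (d + 1) (by omega)
  set E : ℝ := (((d + 1 : ℕ) : ℝ) * sL) ^ 2 * C with hE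
  have hE0 : 0 ≤ E := by positivity
  set ρfac : ℕ := (d + 1) * sL + 2 * (ℓ + 1) with hρfac
  set t : ℕ := ⌈8 * B₀ * E * ((ℓ : ℝ) + 1) ^ 2⌉₊ + 1 with ht
  have ht1 : 1 ≤ t := by omega
  have htr : (0 : ℝ) < t := by exact_mod_cast ht1
  have ht8 : 8 * B₀ * E * ((ℓ : ℝ) + 1) ^ 2 ≤ t := by
    rw [ht]; push_cast
    exact (Nat.le_ceil _).trans (le_add_of_nonneg_right zero_le_one)
  set A₁ : ℝ := 1 + 2 * E * (ρfac : ℝ) * ((ℓ : ℝ) + 1) ^ 3 * t with hA₁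
  have hA₁1 : 1 ≤ A₁ := by
    have h0 : (0 : ℝ) ≤ 2 * E * (ρfac : ℝ) * ((ℓ : ℝ) + 1) ^ 3 * t := by positivity
    rw [hA₁]; linarith
  refine ⟨2 * B₀ * A₁, ρ₀, M₀, N₀, max R₀ ((1 + 4 * (t ^ 2 * ρfac)) * (ℓ + 1) + 3), by positivity, ?_⟩
  intro η hη K Ω c s R hM0 hρdiv hMdiv hRρ hR0' hN01 hρ0 hΩ φ hLan hsupp N hN0 hJ hQcov hout
  have hR0 : R₀ ≤ R := le_trans (le_max_left _ _) hR0'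
  have hwide : (1 + 4 * (t ^ 2 * ρfac)) * (ℓ + 1) + 3 ≤ c.ρ :=
    (le_trans (le_max_right _ _) hR0').trans (le_trans (Nat.le_mul_of_pos_right _ (by positivity)) hRρ)
  -- ### the bootstrap quantity `G` over the dented tower (inside `□₀`)
  have hsub : ∀ j, j ≤ c.k → c.sq j ⊆ cubeZ (ℓ + 1) c.a c.M c.ρ c.k 0 := fun j hj =>
    (c.sq_subset_cube hj).trans (B8Eq131CubesRec.cube_anti hoddL (Nat.zero_le j) hj)
  obtain ⟨G, hG0, hGub, hGlub⟩ := exists_weighted_max_of_subset η c.a c.M c.ρ c.k c.k c.sq hsub φ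
  set Ξ : ℝ := E * (2 * ((ℓ : ℝ) + 1) ^ 2 * G + (t : ℝ) ^ 2 * (ρfac : ℝ) * ((ℓ : ℝ) + 1) ^ 3 * N) / t with hΞ
  have hΞ0 : 0 ≤ Ξ := by positivity
  set N' : ℝ := N + 2 * Ξ with hN'
  have hNN' : N ≤ N' := by rw [hN']; linarith
  have hN'0 : 0 ≤ N' := hN0.trans hNN'
  -- ### the straight datum on print's class of the dented member
  have hQ : ∀ j, j ≤ c.k → ∀ b ∈ c.lamBPZ j, ‖linQIterZ (ℓ + 1) (iEta η φ) j b.1 b.2‖ ≤ N' := by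
    intro j hjk b hb
    have hcov := hQcov j hjk b hb
    have hid := linCovIterZ_one_eq (ℓ + 1) hLs (iEta η φ) j b.1 b.2
    set Θ := carryIter (fun _ θ w' => rlamZ (ℓ + 1) (1 : SiteZ (d + 1) → Fin (d + 1) → ℂˣ) θ (((ℓ + 1 : ℕ) : ℤ) • w'))
      (fun _ A w' => lamZ (ℓ + 1) (1 : SiteZ (d + 1) → Fin (d + 1) → ℂˣ) A (((ℓ + 1 : ℕ) : ℤ) • w')) (linQIterZ (ℓ + 1) (iEta η φ)) with hΘ
    have hsplit : linQIterZ (ℓ + 1) (iEta η φ) j b.1 b.2 =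
        linCovIterZ (ℓ + 1) 1 (iEta η φ) j b.1 b.2 - dcovF (1 : SiteZ (d + 1) → Fin (d + 1) → ℂˣ) (Θ j) b.1 b.2 := by rw [hid]; abel
    have hbound : ‖Θ j b.1‖ + ‖Θ j (b.1 + e b.2)‖ ≤ 2 * Ξ := by
      rcases j with _ | j₀
      · rw [hΘ, carryIter_zero]; simp only [Pi.zero_apply, norm_zero, add_zero]; positivity
      · obtain ⟨w, hw, hz1, hz2⟩ := exists_near_of_mem_lamBPZ c hb
        have hj₀k : j₀ < c.k := hjk
        have hsq : c.sq j₀ = cubeZ (ℓ + 1) c.a c.M c.ρ c.k j₀ := c.sq_of_lt hj₀k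
        have hJ₀ : ∀ (y : SiteZ (d + 1)) (τ : Fin (d + 1)), y ∈ cubeZ (ℓ + 1) c.a c.M c.ρ c.k j₀ →
            ((((ℓ + 1 : ℕ) : ℝ)) ^ j₀ * η) ^ 3 * ‖Jcur η (1 : SiteZ (d + 1) → Fin (d + 1) → ℂˣ) φ τ y‖ ≤ N := fun y τ hy =>
          hJ j₀ hj₀k.le y τ (bondTouches_of_mem (by rw [hsq]; exact hy) τ)
        have hG₀ : ∀ (y : SiteZ (d + 1)) (τ ν : Fin (d + 1)), y ∈ cubeZ (ℓ + 1) c.a c.M c.ρ c.k j₀ →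
            ((((ℓ + 1 : ℕ) : ℝ)) ^ j₀ * η) ^ 2 * ‖covDerivFwd η (1 : SiteZ (d + 1) → Fin (d + 1) → ℂˣ) ν (fun x => φ x τ) y‖ ≤ G := fun y τ ν hy =>
          hGub j₀ hj₀k.le y τ ν (sideTouches_of_mem hd2 (by rw [hsq]; exact hy) τ)
        have hρw : (ℓ + 1) ^ (j₀ + 1) + (4 * (t ^ 2 * (((d + 1) * sL + 2 * (ℓ + 1)) * (ℓ + 1) ^ (j₀ + 1))) + 3) ≤ c.ρ * (ℓ + 1) ^ j₀ := by
          have hLj : 1 ≤ (ℓ + 1) ^ j₀ := Nat.one_le_pow _ _ (by omega)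
          have h1 : ((1 + 4 * (t ^ 2 * ρfac)) * (ℓ + 1) + 3) * (ℓ + 1) ^ j₀ ≤ c.ρ * (ℓ + 1) ^ j₀ := Nat.mul_le_mul_right _ hwide
          have h2 : (ℓ + 1) ^ (j₀ + 1) + (4 * (t ^ 2 * (((d + 1) * sL + 2 * (ℓ + 1)) * (ℓ + 1) ^ (j₀ + 1))) + 3) ≤
              ((1 + 4 * (t ^ 2 * ρfac)) * (ℓ + 1) + 3) * (ℓ + 1) ^ j₀ :=
            calc (ℓ + 1) ^ (j₀ + 1) + (4 * (t ^ 2 * (((d + 1) * sL + 2 * (ℓ + 1)) * (ℓ + 1) ^ (j₀ + 1))) + 3)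
                ≤ (ℓ + 1) ^ (j₀ + 1) + (4 * (t ^ 2 * (((d + 1) * sL + 2 * (ℓ + 1)) * (ℓ + 1) ^ (j₀ + 1))) + 3 * (ℓ + 1) ^ j₀) := by linarith
              _ = ((1 + 4 * (t ^ 2 * ρfac)) * (ℓ + 1) + 3) * (ℓ + 1) ^ j₀ := by rw [hρfac]; ring
          exact h2.trans h1
        have h1 := norm_carried_iEta_le_level hLs (by omega) hoddL hC0 hC hη φ c.a c.M c.ρ c.k hjk hN0 hJ₀ hG0 hG₀ t ht1 hρw b.1 w hw hz1
        have h2 := norm_carried_iEta_le_level hLs (by omega) hoddL hC0 hC hη φ c.a c.M c.ρ c.k hjk hN0 hJ₀ hG0 hG₀ t ht1 hρw (b.1 + e b.2) w hw hz2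
        have hΞ' : (((d + 1 : ℕ) : ℝ) * sL) ^ 2 * C * (2 * (((ℓ + 1 : ℕ) : ℝ)) ^ 2 * G + (t : ℝ) ^ 2 * (((d + 1 : ℕ) : ℝ) * sL + 2 * ((ℓ + 1 : ℕ) : ℝ)) * (((ℓ + 1 : ℕ) : ℝ)) ^ 3 * N) / t = Ξ := by
          rw [hΞ, hE, hρfac]; push_cast; ring
        rw [hΞ'] at h1 h2
        rw [hΘ]
        linarith
    calc ‖linQIterZ (ℓ + 1) (iEta η φ) j b.1 b.2‖
        = ‖linCovIterZ (ℓ + 1) 1 (iEta η φ) j b.1 b.2 - dcovF (1 : SiteZ (d + 1) → Fin (d + 1) → ℂˣ) (Θ j) b.1 b.2‖ := by rw [hsplit]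
      _ ≤ ‖linCovIterZ (ℓ + 1) 1 (iEta η φ) j b.1 b.2‖ + ‖dcovF (1 : SiteZ (d + 1) → Fin (d + 1) → ℂˣ) (Θ j) b.1 b.2‖ := norm_sub_le _ _
      _ ≤ N + (‖Θ j b.1‖ + ‖Θ j (b.1 + e b.2)‖) := add_le_add hcov (norm_dcovF_one_le _ _ _)
      _ ≤ N + 2 * Ξ := by linarith
  -- ### the straight fact at datum `N′`
  have hJ' : ∀ j, j ≤ c.k → ∀ (y : SiteZ (d + 1)) (τ : Fin (d + 1)), BondTouches (c.sq j) y τ →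
      ((((ℓ + 1 : ℕ) : ℝ)) ^ j * η) ^ 3 * ‖Jcur η (1 : SiteZ (d + 1) → Fin (d + 1) → ℂˣ) φ τ y‖ ≤ N' :=
    fun j hj y τ hb => (hJ j hj y τ hb).trans hNN'
  have hout' : ∀ (y : SiteZ (d + 1)) (τ : Fin (d + 1)), ¬ BondTouches (c.sq 0) y τ → η * ‖φ y τ‖ ≤ N' :=
    fun y τ hb => (hout y τ hb).trans hNN'
  have HS' := HS η hη K Ω c s R hM0 hρdiv hMdiv hRρ hR0 hN01 hρ0 hΩ φ hLan hsupp N' hN'0 hJ' hQ hout'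
  -- ### `G ≤ B₀N′`, a contraction
  have hGle : G ≤ B₀ * N' := hGlub (B₀ * N') (by positivity) fun j hj y τ ν hside => (HS' j hj y τ hside).2.1 ν
  have hcoef : B₀ * (4 * E * ((ℓ : ℝ) + 1) ^ 2 / t) ≤ 1 / 2 := by
    rw [← mul_div_assoc, div_le_iff₀ htr]
    linarith
  set D : ℝ := 2 * B₀ * E * (ρfac : ℝ) * ((ℓ : ℝ) + 1) ^ 3 * t with hD
  have hexp : B₀ * N' = B₀ * N + B₀ * (4 * E * ((ℓ : ℝ) + 1) ^ 2 / t) * G + D * N := by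
    rw [hN', hΞ, hD]; field_simp; ring
  have hcG : B₀ * (4 * E * ((ℓ : ℝ) + 1) ^ 2 / t) * G ≤ 1 / 2 * G := mul_le_mul_of_nonneg_right hcoef hG0
  have hG2 : G ≤ 2 * B₀ * N + 2 * D * N := by linarith
  have hfinal : B₀ * N' ≤ 2 * B₀ * A₁ * N := by
    have hkey : B₀ * N' ≤ 2 * B₀ * N + 2 * D * N := by linarith
    calc B₀ * N' ≤ 2 * B₀ * N + 2 * D * N := hkey
      _ = 2 * B₀ * A₁ * N := by rw [hA₁, hD]; ring
  -- ### conclusion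
  intro j hjk y τ hside
  obtain ⟨h1, h2, h3⟩ := HS' j hjk y τ hside
  exact ⟨h1.trans hfinal, fun ν => (h2 ν).trans hfinal, h3.trans hfinal⟩

/-- ★★★ **[Balaban1985RegularSpaces] (1.59) ∕ (1.62) AT `U₀ = 1` FOR THE RECORD's LINEARISED AVERAGING ON THE DENTED CENTRED CUBE MEMBER — UNCONDITIONAL for every odd `L = ℓ + 1 ≥ 5`**:
the named fact `B8Ineq159FlatCovPrintedRec.Ineq159FlatDentedCubeMemberCovPrintedZ (d+1) (ℓ+1)` (dag-n05-e g39 INTENT-8). [cite: Balaban1985RegularSpaces, (1.59) p.86, (1.62) p.87;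
Balaban1985Variational, (148)–(152) p.301; Balaban1985BackgroundPropagators, (3.14)–(3.15) p.393, Thm 3.3 p.399; Balaban1987RG1, (0.3)–(0.4) pp.252–253] -/
theorem ineq159FlatDentedCubeMemberCovPrintedZ_holds (d ℓ : ℕ) (hℓ : 4 ≤ ℓ) (hodd : Odd (ℓ + 1)) : Ineq159FlatDentedCubeMemberCovPrintedZ (d + 1) (ℓ + 1) :=
  covDented_of_straight d ℓ hℓ hodd (ineq159FlatDentedCubeMemberPrintedZ_holds d ℓ hℓ hodd)

/-- ★★★ **BOTH NAMED FACTS OF `B8Ineq159FlatCovPrintedRec`, as the record crown `gaugedBoundB8DZ_dentedMember_of_cov159` consumes them** (`d ↦ d+1`, `L ↦ ℓ+1`, odd `ℓ+1 ≥ 5`).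
[cite: Balaban1985RegularSpaces, (1.59) p.86, (1.62) p.87; Balaban1985Variational, (148)–(152) p.301; Balaban1987RG1, (0.3)–(0.4) pp.252–253] -/
theorem ineq159FlatCovPrintedZ_holds (d ℓ : ℕ) (hℓ : 4 ≤ ℓ) (hodd : Odd (ℓ + 1)) :
    Ineq159FlatCubeMemberCovPrintedZ (d + 1) (ℓ + 1) ∧ Ineq159FlatDentedCubeMemberCovPrintedZ (d + 1) (ℓ + 1) :=
  ⟨ineq159FlatCubeMemberCovPrintedZ_holds d ℓ hℓ hodd, ineq159FlatDentedCubeMemberCovPrintedZ_holds d ℓ hℓ hodd⟩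

end Bootstrap

end Literature.MathematicalPhysics.QuantumFieldTheory.Balaban1983to89.B8Ineq159FlatCovDentedCubeMemberRec

end
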